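import Mathlib
import Literature.NumberTheory.Irrationality.BrownZudilin2022.GeneralFamily
import Summits.KontsevichZagierPeriods.Zeta5Search.JintegralEulerP12
import Summits.KontsevichZagierPeriods.Zeta5Search.JintegralHprime
import Summits.KontsevichZagierPeriods.Zeta5Search.JintegralH
import HarnessLib

/-!
# ζ(5) search — Brown–Zudilin's invariance (27) under the generators of `G ≅ Σ₇` PROVED: `invariance_of_converges'` holds (cell `pub-zeta5`, seat ct-1 g13)

HONEST FRAMING: systematic search; no irrationality claim unless kernel-certified. Nothing in this file is an
irrationality result, a worthiness exponent or a denominator statement. It DISCHARGES the named Literature fact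
`Literature.NumberTheory.Irrationality.BrownZudilin2022.invariance_of_converges'` [BrownZudilin2022, Sect. 7, eq. (27)]:
for every `a` and each generator `g ∈ {i₁, p₀₁, p₁₂, h, h'}` of `G` with `a` and `g a` convergent,
`I(g a)/∏_{i∈F} h_i(g a)! = I(a)/∏_{i∈F} h_i(a)!`. Brown–Zudilin obtain `h`, `h'` from Bailey's very-well-poised `₇F₆`
transformation (25) applied to the Barnes double integral (16); the kernel proof assembled here is Bailey-free and needs no
chamber: `i₁` (ct-1 g10, `CellularIntegralInvolution`), `p₀₁`, `p₁₂` (ct-1 g12, Euler's `₂F₁` symmetry on (10):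
`JintegralEulerSymmetry`, `JintegralEulerP12`), and `h`, `h'` (ct-1 g13: one Mellin–Barnes integral `JintegralMellinT`, Rhin–Viola's
group acting on the closed `(y₁,y₂,y₃)`-block with complex exponents — `h' = σϑϑσ·φ·ϑϑ`, `h = σφϑ⁴φϑ³` in Rhin–Viola's
elementary generators, `RhinViolaConjugation` — and the re-coupling `JintegralHprime`, `JintegralH`). The hypothesis
`(hInv : invariance_of_converges')` of the cell's conditional results is now dischargeable by `invariance_of_converges'_holds`.

Theorems only (no new definitions); no status word, no `γ`, nothing about ζ(5).
-/

noncomputable section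

namespace Summit.KontsevichZagierPeriods.Zeta5Search.InvarianceOfConverges

open Literature.NumberTheory.Irrationality.BrownZudilin2022
open Summit.KontsevichZagierPeriods.Zeta5Search.JintegralEulerP12 (invariance_of_converges'_of_h_h')
open Summit.KontsevichZagierPeriods.Zeta5Search.JintegralHprime (normalisedIntegral'_genH')
open Summit.KontsevichZagierPeriods.Zeta5Search.JintegralH (normalisedIntegral'_genH)

/-- **Brown–Zudilin's (27) holds for the five generators of `G`** — the named Literature fact `invariance_of_converges'`
is a theorem: for `a` convergent and each of `i₁, p₀₁, p₁₂, h, h'` with `g a` convergent, `I(g a)/∏_{i∈F} h_i(g a)! = I(a)/∏_{i∈F} h_i(a)!`.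
[BrownZudilin2022, Sect. 7, eq. (27); Rhin–Viola, Acta Arith. 97 (2001), §§2–4] -/
theorem invariance_of_converges'_holds : invariance_of_converges' :=
  invariance_of_converges'_of_h_h' (fun _ ha hga => normalisedIntegral'_genH ha hga)
    (fun _ ha hga => normalisedIntegral'_genH' ha hga)

end Summit.KontsevichZagierPeriods.Zeta5Search.InvarianceOfConverges

end
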